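import Summits.CriticalPhenomena.PercolationContinuityZ3.Theses.PercNonProliferation
import Literature.Probability.Percolation.RSW

/-!
# Sketch — crux idea `axis-fold-linear-depth-bgn` (crux stmt-CriticalPhenomena-4445 `FreeBoxSparse`, round 2, ideator 5)

First lemmas of the card, typed over existing declarations (no new Literature notions):

* `axisPt t` = the lattice site `(t, 0, 0)` of `ℤ³`;
* `axisConn ρ m` = `P_{p_c}((-m,0,0) ↔ (m,0,0) inside Λ_{⌈(1+ρ)m⌉})`, the IN-BOX connection probability
  of the axis pair at distance `2m` whose endpoints sit at depth `≈ ρ m` below the two faces they point at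
  (`ρ = 0`: both endpoints ON opposite faces — the Barsky–Grimmett–Newman regime; `ρ > 0`: the crux regime);
* `AxisDecay ρ` : `axisConn ρ m → 0`; `AxisPositive ρ` : `∃ c > 0, axisConn ρ m ≥ c` for infinitely many `m`;
* `FoldLemma` (Thm A of the card, provable now): `¬ FreeBoxSparse → ∃ ρ > 0, AxisPositive ρ`
  (reflection-folding of the pair-averaged in-box connectivity onto the axis, one Harris inequality);
* `ChainLemma` (Thm B, provable now): `AxisPositive ρ → AxisPositive ρ'` for every `0 < ρ' ≤ ρ`
  (Harris chaining of `2k+1` translated axis events; aspect `1+ρ ↦ 1+ρ/(2k+1)`);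
* `axisConn_mono` (proved here): `axisConn` is monotone in `ρ` (box inclusion);
* `freeBoxSparse_of_axisDecay` (proved here from the two lemmas as hypotheses):
  `FoldLemma → ChainLemma → 0 < ρ → AxisDecay ρ → FreeBoxSparse` — the composition the crux-plan
  skeleton would register (`stub_fold`, `stub_chain`, `stub_axisDecay`).
-/

noncomputable section

open MeasureTheory Filter Topology
open Literature.Probability.Percolation Literature.Probability.LatticeModels

namespace Summit.CriticalPhenomena.PercolationContinuityZ3.Cruxes.FreeBoxSparse.AxisFold

/-- The axis site `(t, 0, 0) ∈ ℤ³`. -/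
def axisPt (t : ℤ) : Site 3 := fun i => if i = 0 then t else 0

/-- Half-width of the ambient box at aspect `ρ`: `⌈(1+ρ) m⌉`. -/
def boxRadius (ρ : ℝ) (m : ℕ) : ℕ := ⌈(1 + ρ) * (m : ℝ)⌉₊

/-- `axisConn ρ m = P_{p_c}((-m,0,0) ↔ (m,0,0) inside Λ_{⌈(1+ρ)m⌉})`. -/
def axisConn (ρ : ℝ) (m : ℕ) : ℝ :=
  (bondPercolation (zdGraph 3) (criticalProbI 3)).real
    (openConnIn (↑(box 3 (boxRadius ρ m)) : Set (Site 3)) (axisPt (-(m : ℤ))) (axisPt m))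

/-- `AxisDecay ρ`: the axis-pair in-box connectivity at aspect `1+ρ` tends to `0`. -/
def AxisDecay (ρ : ℝ) : Prop := Tendsto (axisConn ρ) atTop (𝓝 0)

/-- `AxisPositive ρ`: the axis-pair in-box connectivity at aspect `1+ρ` is `≥ c > 0` infinitely often. -/
def AxisPositive (ρ : ℝ) : Prop := ∃ c : ℝ, 0 < c ∧ ∃ᶠ m : ℕ in atTop, c ≤ axisConn ρ m

/-- **Thm A (fold lemma)** — target statement, provable now (card §First lemma): a failure of the crux
folds onto the axis. From `FA₂(n_j) ≥ a`: the displacement function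
`A_n(z) = avg_u P(u ↔ u+z in Λ_n)` has a cube-symmetric level set `{A_n ≥ a/16}` of density `≥ a/17`
in `Λ_{2n}`; a point `z` of it with `z₀ = ‖z‖_∞ ≥ 0.78 a^{1/3} n` and its reflection `Rz = (z₀,-z₁,-z₂)`
give, by one Harris inequality, `P(0 ↔ 2 z₀ e₀ inside Λ_{4n}) ≥ (a/16)²`, i.e. `AxisPositive ρ₀` with
`ρ₀ ≤ 5.2 a^{-1/3}`. -/
def FoldLemma : Prop :=
  ¬ Theses.PercNonProliferation.FreeBoxSparse → ∃ ρ : ℝ, 0 < ρ ∧ AxisPositive ρ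

/-- **Thm B (chain lemma)** — target statement, provable now: Harris chaining of `2k+1` translated copies
of the axis event lowers the aspect, `axisConn (ρ/(2k+1)) ((2k+1) m) ≥ (axisConn ρ m)^{2k+1}`, hence
positivity descends to every smaller aspect `ρ' > 0`. -/
def ChainLemma : Prop :=
  ∀ ρ ρ' : ℝ, 0 < ρ' → ρ' ≤ ρ → AxisPositive ρ → AxisPositive ρ'

/-! ### Proved plumbing: monotonicity in the aspect and the composition -/

theorem boxRadius_mono {ρ ρ' : ℝ} (h : ρ' ≤ ρ) (m : ℕ) : boxRadius ρ' m ≤ boxRadius ρ m := by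
  unfold boxRadius
  exact Nat.ceil_mono (by nlinarith [(Nat.cast_nonneg m : (0 : ℝ) ≤ m)])

/-- In-box connectivity is monotone in the box. -/
theorem openConnIn_mono_set {S S' : Set (Site 3)} (h : S ⊆ S') (x y : Site 3) :
    openConnIn S x y ⊆ openConnIn S' x y := openConnIn_mono h x y

theorem axisConn_mono {ρ ρ' : ℝ} (h : ρ' ≤ ρ) (m : ℕ) : axisConn ρ' m ≤ axisConn ρ m := by
  unfold axisConn
  refine measureReal_mono ?_ (measure_ne_top _ _)
  refine openConnIn_mono_set ?_ _ _
  exact_mod_cast box_mono 3 (boxRadius_mono h m)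

theorem axisConn_nonneg (ρ : ℝ) (m : ℕ) : 0 ≤ axisConn ρ m := measureReal_nonneg

/-- Positivity at a smaller aspect trivially gives positivity at a larger one. -/
theorem AxisPositive.mono {ρ ρ' : ℝ} (h : ρ' ≤ ρ) (hp : AxisPositive ρ') : AxisPositive ρ := by
  obtain ⟨c, hc, hf⟩ := hp
  exact ⟨c, hc, hf.mono fun m hm => hm.trans (axisConn_mono h m)⟩

/-- Decay and positivity at the same aspect are incompatible. -/
theorem not_axisPositive_of_axisDecay {ρ : ℝ} (hd : AxisDecay ρ) : ¬ AxisPositive ρ := by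
  rintro ⟨c, hc, hf⟩
  have hev : ∀ᶠ m : ℕ in atTop, axisConn ρ m < c :=
    (tendsto_order.1 hd).2 c hc
  obtain ⟨m, hm1, hm2⟩ := (hf.and_eventually hev).exists
  exact absurd hm2 (not_lt.2 hm1)

/-- **Composition (the skeleton's `FreeBoxSparse_of`)**: the fold lemma, the chain lemma and axis decay
at ONE aspect `ρ > 0` give the crux. -/
theorem freeBoxSparse_of_axisDecay (hA : FoldLemma) (hB : ChainLemma) {ρ : ℝ} (hρ : 0 < ρ)
    (hd : AxisDecay ρ) : Theses.PercNonProliferation.FreeBoxSparse := by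
  by_contra h
  obtain ⟨ρ₀, hρ₀, hpos⟩ := hA h
  -- descend from ρ₀ to min ρ ρ₀, then go up to ρ
  have h1 : AxisPositive (min ρ ρ₀) := hB ρ₀ (min ρ ρ₀) (lt_min hρ hρ₀) (min_le_right _ _) hpos
  have h2 : AxisPositive ρ := h1.mono (min_le_left _ _)
  exact not_axisPositive_of_axisDecay hd h2

/-! ### The `ρ = 0` endpoint is Barsky–Grimmett–Newman (recorded as a target statement)

At `ρ = 0` both endpoints lie on opposite faces of `Λ_m`; `(m,0,0)` is a site of the inner vertex boundary and
`(-m,0,0)` lies at depth `2m ≥ m` below it, so `axisConn 0 m ≤ P_{p_c}(A_m)` with `A_m = {0 ↔ height ≥ m in ℍ}`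
(tree: `BoxGateway.measure_openConnVia_box_le_halfSpaceReach`), which tends to `0` by
`CerfDembinVanishing.tendsto_measure_halfSpaceReach` and `BarskyGrimmettNewman1991_Z3_holds`. -/
def AxisDecayZero : Prop := AxisDecay 0

end Summit.CriticalPhenomena.PercolationContinuityZ3.Cruxes.FreeBoxSparse.AxisFold

end
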